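import Summits.CriticalPhenomena.PercolationContinuityZ3.Theorems.PercNearOneGluingNoHeavyLowerTailSahiGridPatternRectCert

/-!
# `NoHeavyLowerTail` (crux stmt-CriticalPhenomena-4575), Sahi programme P1: **DIAGONAL CERTIFICATES** — a rectangle certificate
# `h = diag(d)` for a first slot `U ⊆ [3]^k` is a vector `d ≥ 0` on `[3]^k` with `λ_U − d ∈ K*` and `Θ_U(A×A′) ≤ d(A∩A′)`,
# and it proves `U × [3]^n` good in every dimension

Support file (Sahi cell, seat `prim-sahi-p1`, generation 16; `--supports stmt-CriticalPhenomena-4575`).  Pure proofs, NO definitions, no `sorry`,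
standard axioms.  Vocabulary of `…SahiGridPattern{CellForm,CellAtoms,RectCert}` (`cylSet`, `lamU`, `thetaVal`, `PatternPos`).

THE MATHEMATICS.  Generation 15 proved that the census' rectangle (max-tensor) certificates `(†⁺)_k(U)` — a matrix `h ≥ 0` on `[3]^k × [3]^k`,
rectangle-dominated by `diag(λ_U)` and rectangle-dominating `Θ_U` — prove the junta cylinder `U × [3]^n` good for the pattern functional in every
dimension (`sStarD_cylSet_nonneg_of_rectCert`).  The generation-16 computation (kit j156666; seat code `diagcert.c`, exact integer re-verification)
found that for EVERY up-set `U ⊆ [3]^k`, `k ≤ 3` (all 3 + 19 + 979 of them), the certificate can be taken DIAGONAL, `h = diag(d)`: the `3^k × 3^k`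
unknowns collapse to `3^k`, and the two rectangle-copositivity conditions become
  (T)  `Σ_{q ∈ W} d(q) ≤ Σ_{q ∈ W} λ_U(q)`  for every up-set `W`        (i.e. `λ_U − d ∈ K*`, by coefficientwise Harris automatically true for `d = 2^k·1_U`),
  (N)  `Θ_U(A × A′) ≤ Σ_{q ∈ A ∩ A′} d(q)`  for all up-sets `A, A′`   (i.e. `d(W) ≥ Θ*_U(W) := max {Θ_U(A×A′) : A ∩ A′ = W}`).
So `(†_diag)_k(U)` asks for a nonnegative MODULAR set function `W ↦ d(W)` on the lattice of up-sets sandwiched between `Θ*_U` (below) and the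
modular `λ_U` (above); `PatternPos_k` at the slot `U` is exactly `Θ*_U ≤ λ_U`.  Equivalently (`d = 2^k·1_U + e`): a nonnegative flow `e` on the cover
edges inside `U` whose in-flow into every up-set `W` lies between `Θ*_U(W) − 2^k·#(U∩W)` and the Harris slack `2^k·#(U∩W) − N(U;W)`.
THIS FILE records the soundness of diagonal certificates in every dimension (**`sStarD_cylSet_nonneg_of_diagCert`**, a specialisation of the
rectangle theorem), the dimension-`k` instance and `patternPos_of_forall_diagCert`, and the two certificate conditions for `U = ⊤`, `d ≡ 2^k` (coefficientwise Harris).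
The trivial choice `d = 2^k·1_U` satisfies (T) for every up-set `U` (`diagCert_T_of_trivial`, Harris again) and, by exhaustive computation, (N) exactly for
the principal up-sets and a few others (k = 2: 10/19, k = 3: 57/979, all 27 principal ones among them) — not claimed here.
Nothing in this file asserts `PatternPos d` for `d ≥ 4` or `(†_diag)_k(U)` for any particular `U ≠ ⊤`. [this work]
-/

namespace Summit.CriticalPhenomena.PercolationContinuityZ3.Theorems.SahiGridPattern

open Finset SahiGrid3
open scoped BigOperators

variable {n k : ℕ}

/-- The intersection of two up-sets (as finsets of `[3]^k`) is an up-set. [this work] -/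
theorem isUpperSet_inter_coe {A A' : Finset (Pd k)} (hA : IsUpperSet (A : Set (Pd k))) (hA' : IsUpperSet (A' : Set (Pd k))) :
    IsUpperSet ((A ∩ A' : Finset (Pd k)) : Set (Pd k)) := by
  rw [Finset.coe_inter]
  exact hA.inter hA'

/-- The rectangle value of a diagonal kernel: `Σ_{q∈A} Σ_{r∈A′} [q = r]·d(q) = Σ_{q ∈ A∩A′} d(q)`. [this work] -/
theorem sum_sum_diag_eq_sum_inter (d : Pd k → ℤ) (A A' : Finset (Pd k)) :
    (∑ q ∈ A, ∑ r ∈ A', (if q = r then d q else 0)) = ∑ q ∈ A ∩ A', d q :=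
  sum_sum_ite_eq_diag A A' d

/-- **DIAGONAL CERTIFICATES ARE SOUND, every `k` and `n`** (`(†_diag)_k(U) ⟹ U × [3]^n` good in every dimension):
if `d ≥ 0` on `[3]^k` satisfies (T) `Σ_{q∈W} d(q) ≤ Σ_{q∈W} λ_U(q)` for every up-set `W` and (N) `Θ_U(A×A′) ≤ Σ_{q∈A∩A′} d(q)` for all up-sets
`A, A′`, then `0 ≤ sStarD (U × [3]^n) B C` for all up-sets `B, C ⊆ [3]^{n+k}`.  (The rectangle theorem with `h = diag(d)`.) [this work] -/
theorem sStarD_cylSet_nonneg_of_diagCert (U : Finset (Pd k)) (d : Pd k → ℤ) (hd : ∀ q, 0 ≤ d q)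
    (hT : ∀ W : Finset (Pd k), IsUpperSet (W : Set (Pd k)) → (∑ q ∈ W, d q) ≤ ∑ q ∈ W, lamU U q)
    (hN : ∀ A A' : Finset (Pd k), IsUpperSet (A : Set (Pd k)) → IsUpperSet (A' : Set (Pd k)) →
      (∑ q ∈ A, ∑ r ∈ A', thetaVal U q r) ≤ ∑ q ∈ A ∩ A', d q)
    {B C : Finset (Pd (n + k))} (hB : IsUpperSet (B : Set (Pd (n + k)))) (hC : IsUpperSet (C : Set (Pd (n + k)))) :
    0 ≤ sStarD (cylSet U : Finset (Pd (n + k))) B C := by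
  refine sStarD_cylSet_nonneg_of_rectCert U (fun q r => if q = r then d q else 0) ?_ ?_ ?_ hB hC
  · intro q r
    show 0 ≤ (if q = r then d q else 0)
    split_ifs
    · exact hd q
    · exact le_rfl
  · intro A A' hA hA'
    rw [sum_sum_diag_eq_sum_inter d A A']
    exact hT (A ∩ A') (isUpperSet_inter_coe hA hA')
  · intro A A' hA hA'
    rw [sum_sum_diag_eq_sum_inter d A A']
    exact hN A A' hA hA'

/-- **A diagonal certificate proves goodness in the slot's own dimension** (the `n = 0` instance, without the cylinder and without `d ≥ 0`):
(T) and (N) give `0 ≤ sStarD U B C` for all up-sets `B, C ⊆ [3]^k`. [this work] -/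
theorem sStarD_nonneg_of_diagCert (U : Finset (Pd k)) (d : Pd k → ℤ)
    (hT : ∀ W : Finset (Pd k), IsUpperSet (W : Set (Pd k)) → (∑ q ∈ W, d q) ≤ ∑ q ∈ W, lamU U q)
    (hN : ∀ A A' : Finset (Pd k), IsUpperSet (A : Set (Pd k)) → IsUpperSet (A' : Set (Pd k)) →
      (∑ q ∈ A, ∑ r ∈ A', thetaVal U q r) ≤ ∑ q ∈ A ∩ A', d q)
    {B C : Finset (Pd k)} (hB : IsUpperSet (B : Set (Pd k))) (hC : IsUpperSet (C : Set (Pd k))) :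
    0 ≤ sStarD U B C := by
  rw [sStarD_eq_sum_lamU_sub_sum_thetaVal]
  have h1 := hT (B ∩ C) (isUpperSet_inter_coe hB hC)
  have h2 := hN B C hB hC
  linarith

/-- **`PatternPos k` from diagonal certificates**: if every up-set `U ⊆ [3]^k` admits `d` with (T) and (N), then `PatternPos k` (and, with
`d ≥ 0`, every `U × [3]^n` is good in every dimension by `sStarD_cylSet_nonneg_of_diagCert`).  So '`(†_diag)_k(U)` for all `U` and all `k`'
implies `PatternPos d` for all `d`, hence Kahn's Conjecture 5 (`kahnConjecture_of_forall_patternPos`); per `U` this is an LP in only `3^k`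
unknowns (against `9^k` for a general rectangle certificate). [this work] -/
theorem patternPos_of_forall_diagCert
    (hall : ∀ U : Finset (Pd k), IsUpperSet (U : Set (Pd k)) → ∃ d : Pd k → ℤ,
      (∀ W : Finset (Pd k), IsUpperSet (W : Set (Pd k)) → (∑ q ∈ W, d q) ≤ ∑ q ∈ W, lamU U q) ∧
      (∀ A A' : Finset (Pd k), IsUpperSet (A : Set (Pd k)) → IsUpperSet (A' : Set (Pd k)) →
        (∑ q ∈ A, ∑ r ∈ A', thetaVal U q r) ≤ ∑ q ∈ A ∩ A', d q)) :
    PatternPos k := by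
  intro A B C hA hB hC
  obtain ⟨d, hT, hN⟩ := hall A hA
  exact sStarD_nonneg_of_diagCert A d hT hN hB hC

/-! ### The trivial diagonal vector `d = 2^k · 1_U` and the instantiation `U = ⊤` -/

/-- **Condition (T) holds for the trivial vector `d = 2^k·1_U`, for EVERY up-set `U`**: `Σ_{q∈W} 2^k·1_U(q) ≤ Σ_{q∈W} λ_U(q)`, i.e.
`N(U;W) ≤ 2^k·#(U ∩ W)` — coefficientwise Harris (`tdPairs_le_card_inter`).  (So `(†_diag)_k(U)` with the trivial `d` is just condition (N):
`Θ_U(A×A′) ≤ 2^k·#(A∩A′∩U)`; by computation this holds for all principal `U` at `k ≤ 3` but fails for general `U` from `k = 2` on.) [this work] -/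
theorem diagCert_T_of_trivial (U W : Finset (Pd k)) (hU : IsUpperSet (U : Set (Pd k))) (hW : IsUpperSet (W : Set (Pd k))) :
    (∑ q ∈ W, (2 : ℤ) ^ k * ind U q) ≤ ∑ q ∈ W, lamU U q := by
  have hH := tdPairs_le_card_inter U W hU hW
  -- `Σ_{q∈W} ν_U(q) = #{(p,q) ∈ U × W : p δ̸ q}`
  have hnu : (∑ q ∈ W, (nuCount U q : ℤ)) = (((U ×ˢ W).filter fun pq => TotDist pq.1 pq.2 = true).card : ℤ) := by
    unfold nuCount
    rw [Finset.card_filter, Nat.cast_sum, Finset.sum_product, Finset.sum_comm]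
    refine Finset.sum_congr rfl fun q _ => ?_
    rw [Finset.card_filter, Nat.cast_sum]
  -- `Σ_{q∈W} 1_U(q) = #(U ∩ W)`
  have hind : (∑ q ∈ W, ind U q) = ((U ∩ W).card : ℤ) := by
    unfold ind
    rw [Finset.sum_boole, Finset.filter_mem_eq_inter, Finset.inter_comm]
  have hlam : (∑ q ∈ W, lamU U q) = 2 * 2 ^ k * (∑ q ∈ W, ind U q) - ∑ q ∈ W, (nuCount U q : ℤ) := by
    unfold lamU
    rw [Finset.sum_sub_distrib, ← Finset.mul_sum]
  rw [hlam, hnu, ← Finset.mul_sum, hind]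
  linarith

/-- **Condition (N) for the whole cube with `d ≡ 2^k`**: `Θ_⊤(A×A′) = #{(q,r) ∈ A×A′ : q δ̸ r} ≤ 2^k·#(A ∩ A′)` (coefficientwise Harris). [this work] -/
theorem diagCert_N_univ (A A' : Finset (Pd k)) (hA : IsUpperSet (A : Set (Pd k))) (hA' : IsUpperSet (A' : Set (Pd k))) :
    (∑ q ∈ A, ∑ r ∈ A', thetaVal (univ : Finset (Pd k)) q r) ≤ ∑ _q ∈ A ∩ A', (2 : ℤ) ^ k := by
  have h := rectCert_univ_T A A' hA hA'
  simp_rw [lamU_univ] at h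
  exact h

/-- **Condition (T) for the whole cube with `d ≡ 2^k`** (with equality: `λ_⊤ ≡ 2^k`). [this work] -/
theorem diagCert_T_univ (W : Finset (Pd k)) :
    (∑ _q ∈ W, ((2 : ℤ) ^ k)) ≤ ∑ q ∈ W, lamU (univ : Finset (Pd k)) q := by
  simp_rw [lamU_univ]
  exact le_rfl

/- The whole-cube cylinder `⊤ × [3]^n` is then good in every dimension through `sStarD_cylSet_nonneg_of_diagCert` with `d ≡ 2^k`
   (`diagCert_T_univ`, `diagCert_N_univ`); the resulting statement coincides with the landed `sStarD_cylSet_univ_nonneg_of_rectCert`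
   and is not re-declared here. -/

/-! ### Appendix (same generation): the forced structure of a diagonal certificate — row sums of `Θ_U`, the lower envelope `2^k·1_U ≼ d`,
and the total mass `d(⊤) = 2^k·#U` -/

/-- **Row sums of `Θ`**: `Σ_q Θ_U(q,y) = 2^k · 1_U(y)` (every `k`): through the chart around `y` the two counting terms cancel
(`r ↦ q̄r` is an involution of the `2^k` points `δ̸ y`). [this work] -/
theorem sum_thetaVal_univ_eq (U : Finset (Pd k)) (y : Pd k) :
    (∑ q : Pd k, thetaVal U q y) = 2 ^ k * ind U y := by
  have h := sum_thetaVal_eq_card U (univ : Finset (Pd k)) y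
  have hfam : fam y (univ : Finset (Pd k)) = univ := by
    ext T; simp [mem_fam]
  rw [hfam, Finset.univ_inter, Finset.univ_inter, Finset.card_compls, Finset.card_univ, Fintype.card_finset,
    Fintype.card_fin] at h
  rw [h]
  push_cast
  ring

/-- `Σ_{r∈W} 1_U(r) = #(U ∩ W)`. [this work] -/
theorem sum_ind_eq_card_inter (U W : Finset (Pd k)) : (∑ r ∈ W, ind U r) = ((U ∩ W).card : ℤ) := by
  unfold ind
  rw [Finset.sum_boole, Finset.filter_mem_eq_inter, Finset.inter_comm]

/-- **A diagonal certificate dominates `2^k·1_U` on up-sets**: condition (N) applied to the pair `(⊤, W)` gives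
`2^k · #(U ∩ W) ≤ Σ_{q∈W} d(q)` for every up-set `W` (so `d − 2^k·1_U ∈ K*`: `d` is `2^k·1_U` with mass moved upward; in particular
`supp d ⊆ U` whenever `d ≥ 0`, since `(λ_U − d)(⊤) = 0` by `diagCert_total_eq`). [this work] -/
theorem diagCert_lower_of_N (U : Finset (Pd k)) (d : Pd k → ℤ)
    (hN : ∀ A A' : Finset (Pd k), IsUpperSet (A : Set (Pd k)) → IsUpperSet (A' : Set (Pd k)) →
      (∑ q ∈ A, ∑ r ∈ A', thetaVal U q r) ≤ ∑ q ∈ A ∩ A', d q)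
    (W : Finset (Pd k)) (hW : IsUpperSet (W : Set (Pd k))) :
    2 ^ k * ((U ∩ W).card : ℤ) ≤ ∑ q ∈ W, d q := by
  have hu : IsUpperSet ((univ : Finset (Pd k)) : Set (Pd k)) := by
    rw [Finset.coe_univ]; exact isUpperSet_univ
  have h := hN univ W hu hW
  rw [Finset.univ_inter] at h
  have e : (∑ q ∈ (univ : Finset (Pd k)), ∑ r ∈ W, thetaVal U q r) = 2 ^ k * ((U ∩ W).card : ℤ) := by
    rw [Finset.sum_comm]
    simp_rw [sum_thetaVal_univ_eq]
    rw [← Finset.mul_sum, sum_ind_eq_card_inter]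
  linarith

/-- `Σ_q λ_U(q) = 2^k · #U` (every point has `2^k` totally distinct partners, so `Σ_q ν_U(q) = 2^k·#U`). [this work] -/
theorem sum_lamU_univ_eq (U : Finset (Pd k)) : (∑ q : Pd k, lamU U q) = 2 ^ k * (U.card : ℤ) := by
  have hnu : (∑ q : Pd k, (nuCount U q : ℤ)) = 2 ^ k * (U.card : ℤ) := by
    unfold nuCount
    have h1 : ∀ q : Pd k, (((U.filter fun p => TotDist p q = true).card : ℕ) : ℤ) =
        ∑ p ∈ U, (if TotDist p q = true then (1:ℤ) else 0) := by
      intro q; rw [Finset.card_filter, Nat.cast_sum]; push_cast; rfl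
    simp_rw [h1]
    rw [Finset.sum_comm]
    have h2 : ∀ p ∈ U, (∑ q : Pd k, if TotDist p q = true then (1:ℤ) else 0) = 2 ^ k := by
      intro p _
      have h3 : ∀ q : Pd k, (if TotDist p q = true then (1:ℤ) else 0) = (if TotDist q p = true then (1:ℤ) else 0) := by
        intro q
        by_cases hpq : TotDist p q = true
        · rw [if_pos hpq, if_pos (totDist_comm.1 hpq)]
        · have hqp : ¬ TotDist q p = true := fun hh => hpq (totDist_comm.1 hh)
          rw [if_neg hpq, if_neg hqp]
      simp_rw [h3]
      exact sum_ite_totDist_eq_pow p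
    rw [Finset.sum_congr rfl h2, Finset.sum_const, nsmul_eq_mul]
    ring
  have hind : (∑ q : Pd k, ind U q) = (U.card : ℤ) := by
    rw [sum_ind_eq_card_inter, Finset.inter_univ]
  unfold lamU
  rw [Finset.sum_sub_distrib, ← Finset.mul_sum, hind, hnu]
  ring

/-- **The total mass of a diagonal certificate is forced**: (T) and (N) give `Σ_q d(q) = 2^k · #U`. [this work] -/
theorem diagCert_total_eq (U : Finset (Pd k)) (d : Pd k → ℤ)
    (hT : ∀ W : Finset (Pd k), IsUpperSet (W : Set (Pd k)) → (∑ q ∈ W, d q) ≤ ∑ q ∈ W, lamU U q)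
    (hN : ∀ A A' : Finset (Pd k), IsUpperSet (A : Set (Pd k)) → IsUpperSet (A' : Set (Pd k)) →
      (∑ q ∈ A, ∑ r ∈ A', thetaVal U q r) ≤ ∑ q ∈ A ∩ A', d q) :
    (∑ q : Pd k, d q) = 2 ^ k * (U.card : ℤ) := by
  have hu : IsUpperSet ((univ : Finset (Pd k)) : Set (Pd k)) := by
    rw [Finset.coe_univ]; exact isUpperSet_univ
  have h1 := hT univ hu
  rw [sum_lamU_univ_eq] at h1
  have h2 := diagCert_lower_of_N U d hN univ hu
  rw [Finset.inter_univ] at h2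
  exact le_antisymm h1 h2

end Summit.CriticalPhenomena.PercolationContinuityZ3.Theorems.SahiGridPattern
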